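import Literature.Dynamics.Ergodic.InvariantMeasuresCompactConvex
import Literature.Dynamics.Ergodic.KrylovBogolyubovSemiflow
import Mathlib.MeasureTheory.Integral.DominatedConvergence
import HarnessLib

/-!
# Quasi-regular points (Kryloff–Bogoliouboff, Oxtoby): the time averages of EVERY continuous
# function converge at almost every point, for every invariant measure — so quasi-regular points
# exist for every continuous map / semiflow of a non-empty compact metrisable space

Topic `Literature/Dynamics/Ergodic`. J. C. Oxtoby, *Ergodic sets*, Bull. AMS 58 (1952), §2
p. 118: «A point `p` in `Ω` is called quasi-regular (`p ∈ Q`) if the mean value `M(f, p)` is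
defined for every `f ∈ C(Ω)`» and **(2.2) «`Q` is a Borel set of invariant measure one.»**, with
«It follows from (2.1) [= Kryloff–Bogoliouboff: every compact system admits a normalized invariant
Borel measure] that any such set is nonempty». Here (theorems only, no definition, no named fact):

* `ae_forall_exists_tendsto_birkhoffAverage` — (2.2) without the Borel-measurability clause: for a
  continuous `T` on a compact metrisable `X` and a `T`-invariant Borel probability measure `μ`,
  for `μ`-a.e. `x` the Birkhoff averages `N⁻¹ Σ_{k<N} f(Tᵏx)` converge for EVERY `f ∈ C(X, ℝ)`
  (Birkhoff's theorem — the tree's `birkhoff_ergodic_theorem_holds` — along a countable dense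
  subset of `C(X, ℝ)`, then a `3ε` Cauchy argument; the ergodic case with the limit `∫ f dμ` is the
  tree's `UniqueErgodicity.ae_forall_tendsto_birkhoffAverage`);
* `exists_quasiRegularPt` — hence (Kryloff–Bogoliouboff, tree `exists_isProbabilityMeasure_map_eq`)
  a quasi-regular point EXISTS whenever `X` is non-empty;
* `exists_quasiRegularPt_semiflow` — the continuous-time form: for a semiflow `φ` jointly
  continuous on `[0,∞) × X` (`X` compact metric, non-empty) with `φ₀ = id`, some point `x` has
  convergent time averages `N⁻¹ ∫₀ᴺ f(φ_s x) ds` (`N → ∞` in `ℕ`) for every `f ∈ C(X, ℝ)` (the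
  tree's continuous-time Kryloff–Bogoliouboff measure, invariant under every `φ_s`, and the
  discrete statement for the time-one map applied to the averaged observables `∫₀¹ f(φ_s ·) ds`;
  Foias–Manley–Rosa–Temam's time-average measures).

Consumer: the Navier–Stokes crux `FiniteDissipationLiouville` (route LerayQuarterDissipation,
`…Theorems.FiniteDissipationLiouville.ErgodicHull*`: a quasi-regular critical element of the
scaling flow on the compact hull of a Type-I singularity).

## References

* [Oxtoby1952] J. C. Oxtoby, *Ergodic sets*, Bull. Amer. Math. Soc. 58 (1952) 116–136, §2 (2.1),
  (2.2) p. 118.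
* [KryloffBogoliouboff1937] N. Kryloff, N. Bogoliouboff, Ann. of Math. 38 (1937) 65–113.
* [FMRTTurbulence2001] C. Foias, O. Manley, R. Rosa, R. Temam, *Navier–Stokes Equations and
  Turbulence* (2001), Ch. IV §3.1 Prop. 3.1 (time-average measures).
* [Walters1982] P. Walters, *An Introduction to Ergodic Theory*, GTM 79 (1982), §1.6 (Birkhoff),
  §6.2 Cor. 6.9.1.
-/

noncomputable section

open MeasureTheory Filter Set Function Topology
open scoped Topology

namespace Literature.Dynamics.Ergodic

/-! ### Discrete time -/

section Discrete

variable {X : Type*} [TopologicalSpace X] [TopologicalSpace.MetrizableSpace X] [CompactSpace X]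

omit [TopologicalSpace.MetrizableSpace X] in
/-- `|A_N f(x) − A_N g(x)| ≤ ‖f − g‖_∞` for Birkhoff averages of continuous functions. [folklore] -/
private theorem abs_birkhoffAverage_sub_birkhoffAverage_le {T : X → X} (f g : C(X, ℝ)) (N : ℕ) (x : X) :
    |birkhoffAverage ℝ T f N x - birkhoffAverage ℝ T g N x| ≤ ‖f - g‖ := by
  rcases Nat.eq_zero_or_pos N with rfl | hN
  · simp only [birkhoffAverage_zero, sub_self, abs_zero]
    exact norm_nonneg _
  have h : birkhoffAverage ℝ T f N x - birkhoffAverage ℝ T g N x =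
      (N : ℝ)⁻¹ * ∑ k ∈ Finset.range N, (f (T^[k] x) - g (T^[k] x)) := by
    simp only [birkhoffAverage, birkhoffSum, smul_eq_mul, Finset.sum_sub_distrib, mul_sub]
  rw [h, abs_mul, abs_inv, Nat.abs_cast, inv_mul_le_iff₀ (by exact_mod_cast hN)]
  calc |∑ k ∈ Finset.range N, (f (T^[k] x) - g (T^[k] x))|
      ≤ ∑ k ∈ Finset.range N, |f (T^[k] x) - g (T^[k] x)| := Finset.abs_sum_le_sum_abs _ _
    _ ≤ ∑ _k ∈ Finset.range N, ‖f - g‖ := Finset.sum_le_sum fun k _ => by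
        rw [← Real.norm_eq_abs]
        exact (f - g).norm_coe_le_norm (T^[k] x)
    _ = N * ‖f - g‖ := by rw [Finset.sum_const, Finset.card_range, nsmul_eq_mul]

/-- **Oxtoby (2.2): almost every point is quasi-regular, for every invariant measure.** For a
continuous map `T` of a compact metrisable space and a `T`-invariant Borel probability measure
`μ`, for `μ`-a.e. `x` the Birkhoff averages `N⁻¹ Σ_{k<N} f(Tᵏx)` converge for EVERY continuous
`f : X → ℝ` (Birkhoff's pointwise ergodic theorem along a countable dense subset of `C(X, ℝ)`;
density and a `3ε` Cauchy estimate for the rest). [cite: Oxtoby1952, §2 (2.2) p. 118] -/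
theorem ae_forall_exists_tendsto_birkhoffAverage [MeasurableSpace X] [BorelSpace X] {T : X → X}
    (hT : Continuous T) (μ : Measure X) [IsProbabilityMeasure μ] (hμ : Measure.map T μ = μ) :
    ∀ᵐ x ∂μ, ∀ f : C(X, ℝ), ∃ ℓ : ℝ, Tendsto (fun N => birkhoffAverage ℝ T f N x) atTop (𝓝 ℓ) := by
  letI : MetricSpace X := TopologicalSpace.metrizableSpaceMetric X
  have hmp : MeasurePreserving T μ μ := ⟨hT.measurable, hμ⟩
  obtain ⟨D, hDc, hDd⟩ := TopologicalSpace.exists_countable_dense C(X, ℝ)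
  have hD : ∀ᵐ x ∂μ, ∀ g ∈ D, ∃ ℓ : ℝ, Tendsto (fun N => birkhoffAverage ℝ T g N x) atTop (𝓝 ℓ) := by
    rw [ae_ball_iff hDc]
    intro g _
    obtain ⟨gstar, -, -, -, hae⟩ := birkhoff_ergodic_theorem_holds μ T hmp g
      ((g : C(X, ℝ)).continuous.integrable_of_hasCompactSupport (HasCompactSupport.of_compactSpace _))
    filter_upwards [hae] with x hx
    exact ⟨gstar x, hx⟩
  filter_upwards [hD] with x hx
  intro f
  refine cauchySeq_tendsto_of_complete (Metric.cauchySeq_iff.2 fun ε hε => ?_)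
  obtain ⟨g, hgD, hfg⟩ := hDd.exists_dist_lt f (by positivity : (0 : ℝ) < ε / 3)
  rw [dist_eq_norm] at hfg
  obtain ⟨ℓ, hℓ⟩ := hx g hgD
  obtain ⟨N₀, hN₀⟩ := Metric.cauchySeq_iff.1 hℓ.cauchySeq (ε / 3) (by positivity)
  refine ⟨N₀, fun m hm n hn => ?_⟩
  have h1 : dist (birkhoffAverage ℝ T f m x) (birkhoffAverage ℝ T g m x) ≤ ‖f - g‖ := by
    rw [Real.dist_eq]; exact abs_birkhoffAverage_sub_birkhoffAverage_le f g m x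
  have h2 : dist (birkhoffAverage ℝ T g n x) (birkhoffAverage ℝ T f n x) ≤ ‖f - g‖ := by
    rw [dist_comm, Real.dist_eq]; exact abs_birkhoffAverage_sub_birkhoffAverage_le f g n x
  have h3 := hN₀ m hm n hn
  calc dist (birkhoffAverage ℝ T f m x) (birkhoffAverage ℝ T f n x)
      ≤ dist (birkhoffAverage ℝ T f m x) (birkhoffAverage ℝ T g m x) +
          dist (birkhoffAverage ℝ T g m x) (birkhoffAverage ℝ T g n x) +
          dist (birkhoffAverage ℝ T g n x) (birkhoffAverage ℝ T f n x) := dist_triangle4 _ _ _ _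
    _ < ε / 3 + ε / 3 + ε / 3 := by linarith
    _ = ε := by ring

/-- **Quasi-regular points exist** (Kryloff–Bogoliouboff; Oxtoby (2.1)–(2.2): «It follows from
(2.1) that any such set is nonempty»): a continuous map of a non-empty compact metrisable space
has a point at which the Birkhoff averages of every continuous function converge.
[cite: Oxtoby1952, §2 (2.1)–(2.2) p. 118] -/
theorem exists_quasiRegularPt [Nonempty X] {T : X → X} (hT : Continuous T) :
    ∃ x : X, ∀ f : C(X, ℝ), ∃ ℓ : ℝ, Tendsto (fun N => birkhoffAverage ℝ T f N x) atTop (𝓝 ℓ) := by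
  letI : MeasurableSpace X := borel X
  haveI : BorelSpace X := ⟨rfl⟩
  obtain ⟨μ, hμ, hμT⟩ := UniqueErgodicity.exists_isProbabilityMeasure_map_eq hT
  haveI : NeZero μ := ⟨IsProbabilityMeasure.ne_zero μ⟩
  exact (ae_forall_exists_tendsto_birkhoffAverage hT μ hμT).exists

end Discrete

/-! ### Continuous time -/

section Semiflow

variable {X : Type*} [MetricSpace X] [CompactSpace X]

/-- **Quasi-regular points of a semiflow.** Let `φ` be a semiflow on a non-empty compact metric
space — jointly continuous on `[0,∞) × X`, `φ_{s+t} = φ_s ∘ φ_t` (`s, t ≥ 0`), `φ₀ = id`. Then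
some point `x` has convergent time averages `N⁻¹ ∫₀ᴺ f(φ_s x) ds` (`N → ∞` through `ℕ`) for EVERY
continuous `f` (the tree's continuous-time Kryloff–Bogoliouboff measure is invariant under the
time-one map; apply `ae_forall_exists_tendsto_birkhoffAverage` to it and to the averaged
observables `y ↦ ∫₀¹ f(φ_s y) ds`, whose Birkhoff sums are `∫₀ᴺ f(φ_s x) ds`).
[cite: Oxtoby1952, §2 (2.2) p. 118 (time-one map)] [cite: FMRTTurbulence2001, Ch. IV §3.1 Prop. 3.1 (time-average measures)] -/
theorem exists_quasiRegularPt_semiflow [Nonempty X] {φ : ℝ → X → X}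
    (hcont : ContinuousOn (fun q : ℝ × X => φ q.1 q.2) (Ici 0 ×ˢ univ))
    (hadd : ∀ s t : ℝ, 0 ≤ s → 0 ≤ t → ∀ y : X, φ (s + t) y = φ s (φ t y))
    (h0 : ∀ y : X, φ 0 y = y) :
    ∃ x : X, ∀ f : C(X, ℝ), ∃ ℓ : ℝ,
      Tendsto (fun N : ℕ => (N : ℝ)⁻¹ * ∫ s in (0 : ℝ)..N, f (φ s x)) atTop (𝓝 ℓ) := by
  letI : MeasurableSpace X := borel X
  haveI : BorelSpace X := ⟨rfl⟩
  -- Kryloff–Bogoliouboff for the semiflow: one measure invariant under every `φ_s`, `s ≥ 0`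
  obtain ⟨μ, hμ, hμinv, -⟩ :=
    exists_invariantMeasure_tendsto_timeAverage_semiflow hcont hadd (Classical.arbitrary X)
      (T := fun k : ℕ => (k : ℝ) + 1) (fun k => by positivity)
      (tendsto_atTop_add_const_right _ 1 tendsto_natCast_atTop_atTop)
      (𝒰 := Ultrafilter.of atTop) (Ultrafilter.of_le atTop)
  have hφ1 : Continuous (φ 1) := continuous_semiflow_apply hcont zero_le_one
  -- the flow composed with `max · 0` is jointly continuous on all of `X × ℝ`
  have hjoint' : Continuous fun q : X × ℝ => φ (max q.2 0) q.1 := by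
    have h1 : Continuous fun q : X × ℝ => ((max q.2 0, q.1) : ℝ × X) := by fun_prop
    exact hcont.comp_continuous h1 fun q => Set.mk_mem_prod (Set.mem_Ici.2 (le_max_right _ _)) (Set.mem_univ _)
  -- the averaged observables are continuous
  have hbar : ∀ f : C(X, ℝ), Continuous fun y : X => ∫ s in (0 : ℝ)..1, f (φ (max s 0) y) := fun f =>
    intervalIntegral.continuous_parametric_intervalIntegral_of_continuous' (μ := volume)
      (f := fun y s => f (φ (max s 0) y)) (f.continuous.comp hjoint') 0 1
  haveI : NeZero μ := ⟨IsProbabilityMeasure.ne_zero μ⟩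
  obtain ⟨x, hx⟩ := (ae_forall_exists_tendsto_birkhoffAverage hφ1 μ (hμinv 1 zero_le_one)).exists
  refine ⟨x, fun f => ?_⟩
  -- iterates of the time-one map are the semiflow at integer times
  have hiter : ∀ k : ℕ, (φ 1)^[k] x = φ k x := by
    intro k
    induction k with
    | zero => simp [h0]
    | succ k ih =>
      rw [Function.iterate_succ_apply', ih, ← hadd 1 k zero_le_one k.cast_nonneg]
      push_cast
      ring_nf
  have hcorb : Continuous fun s : ℝ => f (φ (max s 0) x) :=
    f.continuous.comp (hjoint'.comp (Continuous.prodMk_right x))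
  -- Birkhoff averages of the averaged observable = time averages along the orbit
  obtain ⟨ℓ, hℓ⟩ := hx ⟨_, hbar f⟩
  refine ⟨ℓ, hℓ.congr fun N => ?_⟩
  have hk : ∀ k : ℕ, (∫ s in (0 : ℝ)..1, f (φ (max s 0) ((φ 1)^[k] x))) =
      ∫ s in (k : ℝ)..(k : ℝ) + 1, f (φ (max s 0) x) := by
    intro k
    rw [hiter]
    have e1 : (∫ s in (0 : ℝ)..1, f (φ (max s 0) (φ (↑k) x))) =
        ∫ s in (0 : ℝ)..1, (fun s => f (φ (max s 0) x)) (s + k) := by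
      refine intervalIntegral.integral_congr fun s hs => ?_
      rw [uIcc_of_le zero_le_one] at hs
      show f (φ (max s 0) (φ (↑k) x)) = f (φ (max (s + ↑k) 0) x)
      rw [max_eq_left hs.1, max_eq_left (add_nonneg hs.1 k.cast_nonneg), hadd s k hs.1 k.cast_nonneg]
    have e2 := intervalIntegral.integral_comp_add_right (a := 0) (b := 1)
      (fun s => f (φ (max s 0) x)) (k : ℝ)
    rw [e1, e2, zero_add, show (1 : ℝ) + k = k + 1 from add_comm _ _]
  have hsum := intervalIntegral.sum_integral_adjacent_intervals (f := fun s => f (φ (max s 0) x))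
    (μ := volume) (a := fun k : ℕ => (k : ℝ)) (n := N) (fun k _ => hcorb.intervalIntegrable _ _)
  simp only [Nat.cast_zero] at hsum
  simp only [birkhoffAverage, birkhoffSum, ContinuousMap.coe_mk, smul_eq_mul]
  congr 1
  simp_rw [hk]
  rw [show (∑ k ∈ Finset.range N, ∫ s in (k : ℝ)..(k : ℝ) + 1, f (φ (max s 0) x)) =
      ∑ k ∈ Finset.range N, ∫ s in ((k : ℕ) : ℝ)..((k + 1 : ℕ) : ℝ), f (φ (max s 0) x) from
    Finset.sum_congr rfl fun k _ => by push_cast; rfl, hsum]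
  refine intervalIntegral.integral_congr fun s hs => ?_
  rw [uIcc_of_le (Nat.cast_nonneg N)] at hs
  show f (φ (max s 0) x) = f (φ s x)
  rw [max_eq_left hs.1]

end Semiflow

end Literature.Dynamics.Ergodic

end
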